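import Summits.AnomalousDissipation.AnomalousDissipation.Theorems.BaireTransferDenseLoudLerayHopfForcesAnatomy
import Summits.AnomalousDissipation.AnomalousDissipation.Theorems.DenseLoudDesignerForces.Negative.WindowBounds

/-!
# `DenseLoudLerayHopfForces` (stmt-AnomalousDissipation-1149), IV: the sequential (convergent-force) form

Support file for the item `DenseLoudLerayHopfForces` of route `BaireTransfer`.  Nothing here closes the item.

The item is filed in Baire–Osgood form (`U ⊆ closure (LHLOUD_j(S,E,ε))` at every level `j`).  Because the
Leray–Hopf loud sets are ANTITONE in the level (`lhLoudSet_antitone`: a witness at viscosity `ν < 1/(j'+1)` is a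
witness at every level `j ≤ j'`), density at every level is the same as the existence, through EVERY point `c⋆` of
the window, of ONE diagonal sequence of loud forces `c_j → c⋆` (§1, abstract; §2, the item).  Written out, the item
is therefore VERBATIM the summit `AnomalousDissipation = Literature.Turb.ZerothLaw` — viscosities `ν_j > 0`,
`ν_j → 0`, global Leray–Hopf solutions `u_j` from finite-energy data, `sup_j ⟨‖u_j‖²⟩ ≤ E`,
`inf_j ⟨ν_j‖∇u_j‖²⟩ ≥ ε > 0` — with the single fixed force `f` replaced by a sequence of steady designer forces
`f_{c_j}` CONVERGING IN THE FIXED FINITE-DIMENSIONAL FAMILY `P_S` (hence in every `C^k` norm, with fixed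
frequency support `S`) to `f_{c⋆}`, and this for every `c⋆` of a window and every prescribed stock `S₀ ⊆ S`
(`denseLoudLerayHopfForces_iff_convergentForces`).  The residual between the item and the summit is exactly
"convergent force sequence ↦ constant force sequence" (`anomalousDissipation_of_constantForces`); the residual
between print and the item is exactly the mode of convergence of the designer forces: Cheskidov 2023, Thm. 1.3
(`Literature.Analysis.FluidPDE.cheskidov_time_periodic_anomaly`) and Brué–De Lellis 2023, Thm. 1.1 have
`f^{ν_j} → f` only in `C(ℝ; L²)` / `L¹_t C⁰_x`-type norms with `‖f^{ν_j}‖_{C¹} → ∞`, never inside a fixed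
finite-dimensional space of trigonometric polynomials.
-/

noncomputable section

-- `Summit.<Summit>.<Problem>` is the tree's mandated summit-side namespace (CONVENTIONS §2); for this
-- single-conjunct summit the two coincide, so the duplicate is deliberate.
set_option linter.dupNamespace false

namespace Summit.AnomalousDissipation.AnomalousDissipation.Theorems.DenseLoudLerayHopfForces

open scoped Topology
open Filter Set
open Literature.Analysis.FunctionSpaces Literature.Analysis.FluidPDE
open Summit.AnomalousDissipation.AnomalousDissipation.Theses.BaireTransfer
open Summit.AnomalousDissipation.AnomalousDissipation.Theorems.DenseLoudDesignerForces.Negative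

/-! ## §1 Abstract: density at every level of an antitone family of sets = diagonal approximating sequences -/

/-- In a pseudo-metric space, a point `x` lies in the closure of EVERY member of an antitone sequence of sets
`L 0 ⊇ L 1 ⊇ ⋯` iff `x` is the limit of one diagonal sequence `c` with `c j ∈ L j` for every `j`
(`→`: choose `c j ∈ L j` within distance `1/(j+1)` of `x`; `←`: for `i ≥ j`, `c i ∈ L i ⊆ L j`). -/
theorem forall_mem_closure_iff_exists_tendsto {X : Type*} [PseudoMetricSpace X] {L : ℕ → Set X}
    (hL : Antitone L) (x : X) :
    (∀ j, x ∈ closure (L j)) ↔ ∃ c : ℕ → X, Tendsto c atTop (𝓝 x) ∧ ∀ j, c j ∈ L j := by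
  constructor
  · intro h
    have key : ∀ j : ℕ, ∃ b ∈ L j, dist x b < 1 / ((j : ℝ) + 1) := fun j =>
      Metric.mem_closure_iff.1 (h j) _ Nat.one_div_pos_of_nat
    choose c hcL hcd using key
    refine ⟨c, ?_, hcL⟩
    rw [tendsto_iff_dist_tendsto_zero]
    refine squeeze_zero (fun j => dist_nonneg) (fun j => ?_) tendsto_one_div_add_atTop_nhds_zero_nat
    rw [dist_comm]
    exact (hcd j).le
  · rintro ⟨c, hc, hcL⟩ j
    exact mem_closure_of_tendsto hc (eventually_atTop.2 ⟨j, fun i hi => hL hi (hcL i)⟩)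

/-- Set form of `forall_mem_closure_iff_exists_tendsto`: every member of an antitone sequence of sets is dense in
`U` iff through every point of `U` passes a diagonal sequence `c j ∈ L j` converging to it. -/
theorem forall_subset_closure_iff_exists_tendsto {X : Type*} [PseudoMetricSpace X] {L : ℕ → Set X}
    (hL : Antitone L) (U : Set X) :
    (∀ j, U ⊆ closure (L j)) ↔ ∀ x ∈ U, ∃ c : ℕ → X, Tendsto c atTop (𝓝 x) ∧ ∀ j, c j ∈ L j :=
  ⟨fun h x hx => (forall_mem_closure_iff_exists_tendsto hL x).1 fun j => h j hx,
    fun h j x hx => (forall_mem_closure_iff_exists_tendsto hL x).2 (h x hx) j⟩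

/-- LEVELS BY A VANISHING PARAMETER.  For the level sets `L j = {y | ∃ ν ∈ (0, 1/(j+1)), P ν y}` of a property
`P ν y` ("`y` is loud at viscosity `ν`"), a point `x` lies in the closure of every level iff there are `c_j → x`
and viscosities `ν_j > 0`, `ν_j → 0` (no rate) with `P (ν_j) (c_j)` for all `j`: the levels are antitone, a
level-`j` parameter is `< 1/(j+1) → 0`, and conversely `ν_i < 1/(j+1)` eventually in `i`. -/
theorem forall_mem_closure_levels_iff {X : Type*} [PseudoMetricSpace X] (P : ℝ → X → Prop) (x : X) :
    (∀ j : ℕ, x ∈ closure {y : X | ∃ ν : ℝ, 0 < ν ∧ ν < 1 / ((j : ℝ) + 1) ∧ P ν y}) ↔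
      ∃ (c : ℕ → X) (ν : ℕ → ℝ), Tendsto c atTop (𝓝 x) ∧ (∀ j, 0 < ν j) ∧ Tendsto ν atTop (𝓝 0) ∧
        ∀ j, P (ν j) (c j) := by
  constructor
  · intro h
    have hanti : Antitone (fun j : ℕ => {y : X | ∃ ν : ℝ, 0 < ν ∧ ν < 1 / ((j : ℝ) + 1) ∧ P ν y}) := by
      intro j j' hjj' y hy
      obtain ⟨ν, hν, hνj, hP⟩ := hy
      refine ⟨ν, hν, lt_of_lt_of_le hνj ?_, hP⟩
      have h1 : (0 : ℝ) < (j : ℝ) + 1 := by positivity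
      exact one_div_le_one_div_of_le h1 (by exact_mod_cast Nat.add_le_add_right hjj' 1)
    obtain ⟨c, hc, hcL⟩ := (forall_mem_closure_iff_exists_tendsto hanti x).1 h
    choose ν hν hνj hP using hcL
    exact ⟨c, ν, hc, hν,
      squeeze_zero (fun j => (hν j).le) (fun j => (hνj j).le) tendsto_one_div_add_atTop_nhds_zero_nat, hP⟩
  · rintro ⟨c, ν, hc, hν, hν0, hP⟩ j
    have hev : ∀ᶠ i in atTop, ν i < 1 / ((j : ℝ) + 1) := (tendsto_order.1 hν0).2 _ Nat.one_div_pos_of_nat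
    exact mem_closure_of_tendsto hc (hev.mono fun i hi => ⟨ν i, hν i, hi, hP i⟩)

/-! ## §2 The item in sequential form -/

variable {S : Finset (Fin 3 → ℤ)}

/-- DIAGONAL FORM AT FIXED RATE.  `U ⊆ closure (LHLOUD_j(S,E,ε))` for every `j` iff through every `c⋆ ∈ U`
passes a sequence `c_j → c⋆` in `P_S` with `c_j ∈ LHLOUD_j(S,E,ε)` for EVERY `j` (antitonicity of the
Leray–Hopf loud sets, `lhLoudSet_antitone`). -/
theorem forall_subset_closure_lhLoudSet_iff_exists_tendsto {E ε : ℝ} (U : Set (↥S → EuclideanSpace ℂ (Fin 3))) :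
    (∀ j : ℕ, U ⊆ closure (lhLoudSet S E ε j)) ↔
      ∀ c₀ ∈ U, ∃ c : ℕ → (↥S → EuclideanSpace ℂ (Fin 3)), Tendsto c atTop (𝓝 c₀) ∧
        ∀ j, c j ∈ lhLoudSet S E ε j :=
  forall_subset_closure_iff_exists_tendsto (lhLoudSet_antitone S E ε) U

/-- THE ITEM IN THE SHAPE OF THE SUMMIT (convergent-force form).  `DenseLoudLerayHopfForces` holds iff: for
every finite stock `S₀` there are `S ⊇ S₀`, budgets `E`, `ε > 0` and a non-empty open `U ⊆ P_S` such that for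
EVERY `c⋆ ∈ U` there exist designer forces `c_j → c⋆` in `P_S`, viscosities `ν_j > 0` with `ν_j → 0`, data
`u₀ⱼ` and GLOBAL LERAY–HOPF solutions `u_j` of `NS_{ν_j}` forced by the steady force `f_{c_j}` with
`⟨‖u_j‖²⟩ ≤ E` and `⟨ν_j‖∇u_j‖²⟩ ≥ ε` for all `j`.  Compare `Literature.Turb.ZerothLaw` (= `AnomalousDissipation`):
the same clause list with ONE force `fun _ => f` in place of `fun _ => force S (c j)`, `c j → c⋆`.  So the item is
the zeroth law of turbulence for steady designer forces converging in a fixed finite-dimensional family of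
trigonometric polynomials (fixed degree, every `C^k` norm), locally uniformly in the limit force — strictly beyond
Cheskidov 2023 Thm. 1.3 / Brué–De Lellis 2023 Thm. 1.1, whose forces converge only in rough norms. -/
theorem denseLoudLerayHopfForces_iff_convergentForces :
    DenseLoudLerayHopfForces ↔
      ∀ S₀ : Finset (Fin 3 → ℤ), ∃ S : Finset (Fin 3 → ℤ), S₀ ⊆ S ∧ ∃ (E ε : ℝ), 0 < ε ∧
        ∃ U : Set (↥S → EuclideanSpace ℂ (Fin 3)), IsOpen U ∧ U.Nonempty ∧
          ∀ c₀ ∈ U, ∃ (c : ℕ → (↥S → EuclideanSpace ℂ (Fin 3))) (ν : ℕ → ℝ)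
            (u₀ : ℕ → UnitAddTorus (Fin 3) → EuclideanSpace ℝ (Fin 3))
            (u : ℕ → ℝ → UnitAddTorus (Fin 3) → EuclideanSpace ℝ (Fin 3)),
            Tendsto c atTop (𝓝 c₀) ∧ (∀ j, 0 < ν j) ∧ Tendsto ν atTop (𝓝 0) ∧
              (∀ j, Torus.IsGlobalLerayHopf (ν j) (fun _ => force S (c j)) (u₀ j) (u j)) ∧
              (∀ j, meanEnergy (u j) ≤ E) ∧ ∀ j, ε ≤ meanDissipation (ν j) (u j) := by
  rw [denseLoudLerayHopfForces_iff]
  refine forall_congr' fun S₀ => exists_congr fun S => and_congr_right fun _ => exists_congr fun E =>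
    exists_congr fun ε => and_congr_right fun _ => exists_congr fun U => and_congr_right fun _ =>
    and_congr_right fun _ => ?_
  -- the loudness property at viscosity `ν'` of a coefficient vector `c'`
  set P : ℝ → (↥S → EuclideanSpace ℂ (Fin 3)) → Prop := fun ν' c' =>
    ∃ (u₀ : UnitAddTorus (Fin 3) → EuclideanSpace ℝ (Fin 3)) (u : ℝ → UnitAddTorus (Fin 3) → EuclideanSpace ℝ (Fin 3)),
      Torus.IsGlobalLerayHopf ν' (fun _ => force S c') u₀ u ∧ meanEnergy u ≤ E ∧ ε ≤ meanDissipation ν' u with hP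
  have hL : ∀ j : ℕ, lhLoudSet S E ε j = {y | ∃ ν : ℝ, 0 < ν ∧ ν < 1 / ((j : ℝ) + 1) ∧ P ν y} := fun j => rfl
  constructor
  · intro h c₀ hc₀
    have h' : ∀ j : ℕ, c₀ ∈ closure {y | ∃ ν : ℝ, 0 < ν ∧ ν < 1 / ((j : ℝ) + 1) ∧ P ν y} :=
      fun j => hL j ▸ h j hc₀
    obtain ⟨c, ν, hc, hν, hν0, hPc⟩ := (forall_mem_closure_levels_iff P c₀).1 h'
    choose u₀ u hLH hE hε using hPc
    exact ⟨c, ν, u₀, u, hc, hν, hν0, hLH, hE, hε⟩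
  · intro h j c₀ hc₀
    obtain ⟨c, ν, u₀, u, hc, hν, hν0, hLH, hE, hε⟩ := h c₀ hc₀
    rw [hL j]
    exact (forall_mem_closure_levels_iff P c₀).2 ⟨c, ν, hc, hν, hν0, fun i => ⟨u₀ i, u i, hLH i, hE i, hε i⟩⟩ j

/-- THE RESIDUAL TO THE SUMMIT IS CONSTANCY OF THE FORCE SEQUENCE: if for ONE stock `S` and ONE coefficient vector
`c⋆` the convergent-force witnesses of `denseLoudLerayHopfForces_iff_convergentForces` can be taken with the
CONSTANT force sequence `c_j = c⋆`, that is `AnomalousDissipation` (the force `f_{c⋆}` is smooth, solenoidal and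
mean-free: `isSmooth_force`, `isDivFree_force`, `hasZeroMean_force`). -/
theorem anomalousDissipation_of_constantForces {E ε : ℝ} (hε : 0 < ε) (c₀ : ↥S → EuclideanSpace ℂ (Fin 3))
    (h : ∃ (ν : ℕ → ℝ) (u₀ : ℕ → UnitAddTorus (Fin 3) → EuclideanSpace ℝ (Fin 3))
      (u : ℕ → ℝ → UnitAddTorus (Fin 3) → EuclideanSpace ℝ (Fin 3)),
      (∀ j, 0 < ν j) ∧ Tendsto ν atTop (𝓝 0) ∧
        (∀ j, Torus.IsGlobalLerayHopf (ν j) (fun _ => force S c₀) (u₀ j) (u j)) ∧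
        (∀ j, meanEnergy (u j) ≤ E) ∧ ∀ j, ε ≤ meanDissipation (ν j) (u j)) :
    AnomalousDissipation := by
  obtain ⟨ν, u₀, u, hν, hν0, hu, hEu, hεu⟩ := h
  exact ⟨force S c₀, isSmooth_force S c₀, isDivFree_force S c₀, hasZeroMean_force S c₀, ν, u₀, u, hν, hν0, hu,
    ⟨E, hEu⟩, ε, hε, hεu⟩

end Summit.AnomalousDissipation.AnomalousDissipation.Theorems.DenseLoudLerayHopfForces

end
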